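import Summits.ResolutionOfSingularities.ResolutionOfSingularities.Theorems.HilbertSamuelEliminationSigmaMaxModificationsCorridor3SigmaSurfaceBadness
import Literature.AlgebraicGeometry.Resolution.CartierDivisorReduced
import Literature.AlgebraicGeometry.Resolution.KollarBlowupSequenceFunctors
import Literature.AlgebraicGeometry.Resolution.HypersurfaceTransform
import HarnessLib

/-!
# [OURS · L1 W4.2] σ-LAYER PHASE B′ — `Corridor3SigmaSurfaceBadnessCure`: THE CURE-CURVE STEP ON THE CARRIER — curing a trace list `Γs` along the component
# `c = cl{ζ}` (every member through `c` loses ONE copy of `c`, i.e. is replaced by the colon `(Γ : 𝓟_c)`; the prime divisor ideal `𝓟_c` is adjoined as the new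
# member) and ITS STALK / ORDER / MULTIPLICITY-LIST LAWS: at `ζ` the multiplicity list becomes `CureLaw.cureStep` of the old one, at every other codimension-one
# point it is unchanged, and the configuration `S` is unchanged
# (the carrier-side model of the B′ cure step along a bad component: under coincidence the run's member transforms restrict to `ρᶜ(Γ, 1)` with
# `𝓟_c · ρᶜ(Γ,1) = ρ^*Γ` — res-type-067 `comap_strictTransformHom_controlledTransform` / `exceptional_mul_controlledTransform_comap` — and `ρ = Bl_c D̃` is an
# isomorphism on the regular surface, p550218; res-L1-w42-stub-1 DESIGN CHECK 2 (a); kernel `CureLaw` p553245; crux chain w42 `SigmaMaxModifications`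
# stmt-ResolutionOfSingularities-18506 / conjunct `SigmaMaxModificationsCorridor3` stmt-ResolutionOfSingularities-19249; helper of res-L1-w42-stub-1 (gen 6),
# `--supports stmt-…-19249 --as helper`, counted 0)

HONEST FRAMING. OURS bookkeeping over the tree's Cossart–Piltant divisorial dictionary (`exists_stalkIdeal_eq_maximalIdeal_pow`, `le_primeDivisorIdeal_pow_of_isRegular`,
`exists_stalkIdeal_primeDivisorIdeal_eq_span`, `isPrincipalIdealRing_stalk_of_coheight_eq_one`, `maximalIdeal_pow_succ_ne`; Literature `…PrimeDivisorIdeals`,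
`…DivisorialPart`), Literature `colon` / `stalkIdeal_colon` (`…MarkedIdeals`, `…HypersurfaceTransform`), and this seat's `Boundary.compMults` (p559520) and
`CureLaw.cureStep` (p553245). The identification with the RUN's next trace list (`(E.next C).restrictOff ι′` transported along `D̃_next ≅ Bl_c D̃ ≅ D̃`) is NOT in
this file. NOTHING here is a statement of H. Hironaka's manuscript [Hironaka2017] nor of [CossartJannsenSaito2020]; no named fact. AI-written; AI review is weaker
than expert review.

## Contents (namespace `…Theorems.SigmaMaxModificationsCorridor3.Sigma`)

* `cureMember ζ Γ` (`(Γ : 𝓟_ζ)` if `ζ ∈ supp Γ`, else `Γ`), **`Boundary.cureAlong Γs ζ`** (`Γs.map (cureMember ζ) ++ [𝓟_ζ]`).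
* Orders at a codimension-one point of a regular integral scheme: `idealOrder_congr_stalkIdeal`, `idealOrder_eq_of_stalkIdeal_eq_pow`,
  `idealOrder_primeDivisorIdeal_self'` (`ord_ζ 𝓟_ζ = 1`), `primeDivisorIdeal_mul_colon` (`𝓟_ζ · (Γ : 𝓟_ζ) = Γ` for `ζ ∈ supp Γ`).
* THE LAWS: `stalkIdeal_cureMember_of_not_specializes` (off `cl{ζ}` nothing changes), `stalkIdeal_cureMember_self` (`(Γ : 𝓟)_ζ = 𝔪_ζ^{m−1}`),
  `toNat_idealOrder_cureMember_self` (`ord_ζ` drops by one), `mem_support_cureMember_self_iff` (`ζ` stays on the member iff `m ≥ 2`),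
  `idealOrder_cureMember_of_ne` / `mem_support_cureMember_iff_of_ne` (other codimension-one points: unchanged), `support_cureMember_subset`,
  `Boundary.divisorSet_cureAlong` (`S` unchanged), `Boundary.codimOnePoints_cureAlong`.

VACUITY SELF-CHECK. `cureAlong` is the honest colon/adjoin operation; on the DESIGN-CHECK-2 lists: `[2] ↦ [1, 1] ↦ [1]` (one member tangent along `c`: two cure steps).
-/

noncomputable section

set_option linter.dupNamespace false -- mandated namespace of this single-conjunct summit

open CategoryTheory AlgebraicGeometry TopologicalSpace IsLocalRing
open Summit.ResolutionOfSingularities.ResolutionOfSingularities.Theorems.CampaignW42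
open Literature.AlgebraicGeometry.Resolution Literature.RingTheory.HilbertSamuel

namespace Summit.ResolutionOfSingularities.ResolutionOfSingularities.Theorems.SigmaMaxModificationsCorridor3.Sigma

universe u

open Scheme.IdealSheafData

/-! ## The cured member and the cured list -/

section Defs

variable {D : Scheme.{u}}

open scoped Classical in
/-- [OURS · L1 W4.2] **THE CURED MEMBER along `c = cl{ζ}`**: a member through `ζ` loses one copy of `c` — `(Γ : 𝓟_ζ)` — and a member not through `ζ` is unchanged.
NOT a statement of the manuscript. [folklore] -/
def cureMember (ζ : D) (Γ : D.IdealSheafData) : D.IdealSheafData :=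
  if ζ ∈ (Γ.support : Set D) then colon Γ (primeDivisorIdeal ζ) else Γ

/-- [OURS · L1 W4.2] **THE TRACE LIST CURED ALONG `c = cl{ζ}`**: every member cured, then the prime divisor ideal `𝓟_ζ` adjoined as the NEW (last) member — the
carrier-side model of the B′ cure-curve step. NOT a statement of the manuscript. [folklore] -/
def Boundary.cureAlong (Γs : Boundary D) (ζ : D) : Boundary D :=
  Γs.map (cureMember ζ) ++ [primeDivisorIdeal ζ]

/-- Unfolding. [folklore] -/
theorem cureMember_of_mem {ζ : D} {Γ : D.IdealSheafData} (h : ζ ∈ (Γ.support : Set D)) : cureMember ζ Γ = colon Γ (primeDivisorIdeal ζ) := by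
  classical
  exact if_pos h

/-- Unfolding. [folklore] -/
theorem cureMember_of_not_mem {ζ : D} {Γ : D.IdealSheafData} (h : ζ ∉ (Γ.support : Set D)) : cureMember ζ Γ = Γ := by
  classical
  exact if_neg h

/-- The cured member contains the member (`Γ ≤ (Γ : 𝓟)`). [folklore] -/
theorem le_cureMember (ζ : D) (Γ : D.IdealSheafData) : Γ ≤ cureMember ζ Γ := by
  by_cases h : ζ ∈ (Γ.support : Set D)
  · rw [cureMember_of_mem h]; exact le_colon_self _ _
  · rw [cureMember_of_not_mem h]

/-- Hence its support is contained in the member's. [folklore] -/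
theorem support_cureMember_subset (ζ : D) (Γ : D.IdealSheafData) : ((cureMember ζ Γ).support : Set D) ⊆ (Γ.support : Set D) :=
  Scheme.IdealSheafData.support_antitone (le_cureMember ζ Γ)

/-- Membership in the cured list. [folklore] -/
theorem Boundary.mem_cureAlong_iff {Γs : Boundary D} {ζ : D} {J : D.IdealSheafData} :
    J ∈ Γs.cureAlong ζ ↔ (∃ Γ ∈ Γs, cureMember ζ Γ = J) ∨ J = primeDivisorIdeal ζ := by
  simp [Boundary.cureAlong, List.mem_append, List.mem_map]

end Defs

/-! ## Orders at a codimension-one point -/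

section Orders

variable {D : Scheme.{u}}

/-- The order depends only on the stalk. [folklore] -/
theorem idealOrder_congr_stalkIdeal {I J : D.IdealSheafData} {x : D} (h : stalkIdeal I x = stalkIdeal J x) : idealOrder I x = idealOrder J x := by
  refine le_antisymm ?_ ?_
  · refine ENat.forall_natCast_le_iff_le.mp fun n hn => ?_
    rw [le_idealOrder_iff] at hn ⊢
    rwa [← h]
  · refine ENat.forall_natCast_le_iff_le.mp fun n hn => ?_
    rw [le_idealOrder_iff] at hn ⊢
    rwa [h]

/-- **`I_ζ = 𝔪_ζ^a ⇒ ord_ζ I = a`** at a codimension-one point of a locally Noetherian scheme (`𝔪^{a+1} ≠ 𝔪^a` in the one-dimensional Noetherian local DOMAIN — here we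
only need `𝔪_ζ ≠ 𝔪_ζ²`-type strictness, from `maximalIdeal_pow_succ_ne`). [folklore] -/
theorem idealOrder_eq_of_stalkIdeal_eq_pow [IsIntegral D] [IsLocallyNoetherian D] {I : D.IdealSheafData} {ζ : D} (hζ : Order.coheight ζ = 1) {a : ℕ}
    (h : stalkIdeal I ζ = maximalIdeal (D.presheaf.stalk ζ) ^ a) : idealOrder I ζ = a := by
  refine le_antisymm ?_ ((le_idealOrder_iff I ζ a).mpr h.le)
  by_contra hlt
  have h1 : ((a + 1 : ℕ) : ℕ∞) ≤ idealOrder I ζ := by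
    rw [Nat.cast_succ]
    exact Order.add_one_le_of_lt (not_le.mp hlt)
  rw [le_idealOrder_iff, h] at h1
  exact maximalIdeal_pow_succ_ne (not_isField_stalk_of_coheight_eq_one hζ) a (le_antisymm (Ideal.pow_le_pow_right (Nat.le_succ a)) h1)

/-- **`ord_ζ 𝓟_ζ = 1`.** [folklore] -/
theorem idealOrder_primeDivisorIdeal_self' [IsIntegral D] [IsLocallyNoetherian D] {ζ : D} (hζ : Order.coheight ζ = 1) :
    idealOrder (primeDivisorIdeal ζ) ζ = 1 :=
  idealOrder_eq_of_stalkIdeal_eq_pow hζ (by rw [stalkIdeal_primeDivisorIdeal_self, pow_one])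

/-- **A member through `ζ` is divisible by `𝓟_ζ`: `𝓟_ζ · (Γ : 𝓟_ζ) = Γ`** (regular integral Noetherian carrier: `Γ ≤ 𝓟_ζ` by `le_primeDivisorIdeal_pow_of_isRegular`,
and `𝓟_ζ` has prime principal stalks, which cancel). [folklore] -/
theorem primeDivisorIdeal_mul_colon [IsIntegral D] [IsNoetherian D] (hreg : Scheme.IsRegular D) {ζ : D} (hζ : Order.coheight ζ = 1)
    {Γ : D.IdealSheafData} (h : ζ ∈ (Γ.support : Set D)) : primeDivisorIdeal ζ * colon Γ (primeDivisorIdeal ζ) = Γ := by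
  have hle : Γ ≤ primeDivisorIdeal ζ := by
    have := le_primeDivisorIdeal_pow_of_isRegular hreg hζ (I := Γ) (n := 1) (by rw [pow_one]; exact (mem_support_iff_stalkIdeal_le Γ ζ).mp h)
    rwa [pow_one] at this
  refine ext_of_forall_stalkIdeal_eq fun x => ?_
  rw [stalkIdeal_mul, stalkIdeal_colon]
  by_cases hx : ζ ⤳ x
  · obtain ⟨p, -, hp⟩ := exists_stalkIdeal_primeDivisorIdeal_eq_span hreg.uniqueFactorizationMonoid_stalk hx hζ
    rw [hp]
    exact Ideal.span_singleton_mul_colon_of_le (by rw [← hp]; exact stalkIdeal_mono hle x)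
  · rw [stalkIdeal_primeDivisorIdeal_eq_top hx, Ideal.top_mul]
    exact colon_coe_top _

/-- Hence `supp Γ = cl{ζ} ∪ supp (Γ : 𝓟_ζ)` for a member through `ζ`. [folklore] -/
theorem support_eq_union_of_mem [IsIntegral D] [IsNoetherian D] (hreg : Scheme.IsRegular D) {ζ : D} (hζ : Order.coheight ζ = 1) {Γ : D.IdealSheafData}
    (h : ζ ∈ (Γ.support : Set D)) : (Γ.support : Set D) = closure {ζ} ∪ ((colon Γ (primeDivisorIdeal ζ)).support : Set D) := by
  conv_lhs => rw [← primeDivisorIdeal_mul_colon hreg hζ h]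
  rw [Scheme.IdealSheafData.support_mul, Closeds.coe_sup, coe_support_primeDivisorIdeal]

end Orders

/-! ## The laws of the cured member -/

section Laws

variable {D : Scheme.{u}} [IsIntegral D] [IsNoetherian D]

omit [AlgebraicGeometry.IsIntegral D] in
/-- **OFF `cl{ζ}` NOTHING CHANGES**: at a point to which `ζ` does not specialise, the cured member has the old stalk (`𝓟_ζ` is the unit ideal there). [folklore] -/
theorem stalkIdeal_cureMember_of_not_specializes {ζ x : D} (hx : ¬ ζ ⤳ x) (Γ : D.IdealSheafData) : stalkIdeal (cureMember ζ Γ) x = stalkIdeal Γ x := by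
  by_cases h : ζ ∈ (Γ.support : Set D)
  · rw [cureMember_of_mem h, stalkIdeal_colon, stalkIdeal_primeDivisorIdeal_eq_top hx]
    exact colon_coe_top _
  · rw [cureMember_of_not_mem h]

/-- **AT `ζ`: `(Γ : 𝓟_ζ)_ζ = 𝔪_ζ^{m − 1}`** with `m = ord_ζ Γ ≥ 1` (in the discrete valuation ring `𝒪_{D,ζ}`: `Γ_ζ = 𝔪^m`, `𝓟_ζ = 𝔪 = (t)`, `(t^m : t) = (t^{m−1})`).
[folklore] -/
theorem stalkIdeal_cureMember_self (hreg : Scheme.IsRegular D) {ζ : D} (hζ : Order.coheight ζ = 1) {Γ : D.IdealSheafData} (hΓ0 : Γ ≠ ⊥)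
    (h : ζ ∈ (Γ.support : Set D)) : stalkIdeal (cureMember ζ Γ) ζ = maximalIdeal (D.presheaf.stalk ζ) ^ ((idealOrder Γ ζ).toNat - 1) := by
  obtain ⟨a, ha, hpow⟩ := exists_stalkIdeal_eq_maximalIdeal_pow hreg hζ hΓ0
  have ha1 : 1 ≤ a := by
    have h1 : (1 : ℕ∞) ≤ idealOrder Γ ζ := (one_le_idealOrder_iff Γ ζ).mpr h
    rw [ha] at h1
    exact_mod_cast h1
  rw [cureMember_of_mem h, stalkIdeal_colon, stalkIdeal_primeDivisorIdeal_self, hpow, ha, ENat.toNat_coe]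
  -- `𝔪 = (t)` principal, `t` a non-zero-divisor
  haveI := hreg ζ
  haveI := isPrincipalIdealRing_stalk_of_coheight_eq_one hreg hζ
  obtain ⟨t, ht⟩ := (IsPrincipalIdealRing.principal (maximalIdeal (D.presheaf.stalk ζ))).principal
  have ht' : maximalIdeal (D.presheaf.stalk ζ) = Ideal.span {t} := ht
  have ht0 : t ≠ 0 := by
    intro h0
    rw [h0, Ideal.span_singleton_eq_bot.mpr rfl] at ht'
    exact not_isField_stalk_of_coheight_eq_one hζ (isField_iff_maximalIdeal_eq.mpr ht')
  obtain ⟨b, rfl⟩ := Nat.exists_eq_add_of_le ha1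
  rw [ht', Ideal.span_singleton_pow, Ideal.span_singleton_pow, Nat.add_sub_cancel_left, pow_add, pow_one]
  exact colon_span_mul_span_singleton (mem_nonZeroDivisors_of_ne_zero ht0) _

/-- **THE ORDER AT `ζ` DROPS BY ONE**: `ord_ζ (Γ : 𝓟_ζ) = ord_ζ Γ − 1` (read in `ℕ`). [folklore] -/
theorem toNat_idealOrder_cureMember_self (hreg : Scheme.IsRegular D) {ζ : D} (hζ : Order.coheight ζ = 1) {Γ : D.IdealSheafData} (hΓ0 : Γ ≠ ⊥)
    (h : ζ ∈ (Γ.support : Set D)) : (idealOrder (cureMember ζ Γ) ζ).toNat = (idealOrder Γ ζ).toNat - 1 := by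
  rw [idealOrder_eq_of_stalkIdeal_eq_pow hζ (stalkIdeal_cureMember_self hreg hζ hΓ0 h), ENat.toNat_coe]

/-- **`ζ` STAYS ON THE CURED MEMBER IFF `ord_ζ Γ ≥ 2`.** [folklore] -/
theorem mem_support_cureMember_self_iff (hreg : Scheme.IsRegular D) {ζ : D} (hζ : Order.coheight ζ = 1) {Γ : D.IdealSheafData} (hΓ0 : Γ ≠ ⊥)
    (h : ζ ∈ (Γ.support : Set D)) : ζ ∈ ((cureMember ζ Γ).support : Set D) ↔ 2 ≤ (idealOrder Γ ζ).toNat := by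
  rw [SetLike.mem_coe, mem_support_iff_stalkIdeal_le, stalkIdeal_cureMember_self hreg hζ hΓ0 h]
  constructor
  · intro hle
    by_contra hlt
    have h0 : (idealOrder Γ ζ).toNat - 1 = 0 := by omega
    rw [h0, pow_zero, Ideal.one_eq_top, top_le_iff] at hle
    exact (maximalIdeal.isMaximal _).ne_top hle
  · intro h2
    obtain ⟨b, hb⟩ := Nat.exists_eq_add_of_le (show 1 ≤ (idealOrder Γ ζ).toNat - 1 by omega)
    rw [hb, pow_add, pow_one]
    exact Ideal.mul_le_right

omit [AlgebraicGeometry.IsIntegral D] [AlgebraicGeometry.IsNoetherian D] in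
/-- A member NOT through `ζ` is untouched; in particular `ζ` is not on its cure. [folklore] -/
theorem not_mem_support_cureMember_of_not_mem {ζ : D} {Γ : D.IdealSheafData} (h : ζ ∉ (Γ.support : Set D)) : ζ ∉ ((cureMember ζ Γ).support : Set D) := by
  rwa [cureMember_of_not_mem h]

omit [AlgebraicGeometry.IsIntegral D] in
/-- **AT ANOTHER CODIMENSION-ONE POINT NOTHING CHANGES**: orders. [folklore] -/
theorem idealOrder_cureMember_of_ne {ζ ζ' : D} (hζ : Order.coheight ζ = 1) (hζ' : Order.coheight ζ' = 1) (hne : ζ ≠ ζ') (Γ : D.IdealSheafData) :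
    idealOrder (cureMember ζ Γ) ζ' = idealOrder Γ ζ' :=
  idealOrder_congr_stalkIdeal (stalkIdeal_cureMember_of_not_specializes (not_specializes_of_coheight_eq_one hζ hζ' hne) Γ)

omit [AlgebraicGeometry.IsIntegral D] in
/-- … and support membership. [folklore] -/
theorem mem_support_cureMember_iff_of_not_specializes {ζ x : D} (hx : ¬ ζ ⤳ x) (Γ : D.IdealSheafData) :
    x ∈ ((cureMember ζ Γ).support : Set D) ↔ x ∈ (Γ.support : Set D) := by
  rw [SetLike.mem_coe, SetLike.mem_coe, mem_support_iff_stalkIdeal_le, mem_support_iff_stalkIdeal_le, stalkIdeal_cureMember_of_not_specializes hx]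

/-- **THE CONFIGURATION IS UNCHANGED: `S(cureAlong) = S`** when `ζ ∈ S` is a codimension-one point of the configuration on a regular integral Noetherian carrier
(`supp Γ = cl{ζ} ∪ supp (Γ : 𝓟_ζ)` for the members through `ζ`, and `cl{ζ} ⊆ S`). [folklore] -/
theorem Boundary.divisorSet_cureAlong (hreg : Scheme.IsRegular D) {Γs : Boundary D} {ζ : D} (hζ : ζ ∈ Γs.codimOnePoints) :
    (Γs.cureAlong ζ).divisorSet = Γs.divisorSet := by
  ext x
  simp only [Boundary.mem_divisorSet_iff, Boundary.mem_cureAlong_iff]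
  constructor
  · rintro ⟨J, (⟨Γ, hΓ, rfl⟩ | rfl), hx⟩
    · exact ⟨Γ, hΓ, support_cureMember_subset ζ Γ hx⟩
    · obtain ⟨Γ, hΓ, hζΓ⟩ := Boundary.mem_divisorSet_iff.mp hζ.1
      rw [SetLike.mem_coe, mem_support_primeDivisorIdeal_iff] at hx
      exact ⟨Γ, hΓ, Γ.support.isClosed.closure_subset_iff.mpr (Set.singleton_subset_iff.mpr hζΓ) hx.mem_closure⟩
  · rintro ⟨Γ, hΓ, hx⟩
    by_cases h : ζ ∈ (Γ.support : Set D)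
    · rw [support_eq_union_of_mem hreg hζ.2 h] at hx
      rcases hx with hx | hx
      · exact ⟨primeDivisorIdeal ζ, Or.inr rfl, by rw [SetLike.mem_coe, mem_support_primeDivisorIdeal_iff, specializes_iff_mem_closure]; exact hx⟩
      · exact ⟨cureMember ζ Γ, Or.inl ⟨Γ, hΓ, rfl⟩, by rwa [cureMember_of_mem h]⟩
    · exact ⟨cureMember ζ Γ, Or.inl ⟨Γ, hΓ, rfl⟩, by rwa [cureMember_of_not_mem h]⟩

/-- **… hence the codimension-one points of the configuration are unchanged.** [folklore] -/
theorem Boundary.codimOnePoints_cureAlong (hreg : Scheme.IsRegular D) {Γs : Boundary D} {ζ : D} (hζ : ζ ∈ Γs.codimOnePoints) :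
    (Γs.cureAlong ζ).codimOnePoints = Γs.codimOnePoints := by
  ext x
  rw [Boundary.mem_codimOnePoints_iff, Boundary.mem_codimOnePoints_iff, Boundary.divisorSet_cureAlong hreg hζ]

omit [AlgebraicGeometry.IsNoetherian D] in
/-- The members of the cured list are non-zero. [folklore] -/
theorem Boundary.ne_bot_of_mem_cureAlong {Γs : Boundary D} (hne : ∀ Γ ∈ Γs, Γ ≠ ⊥) {ζ : D} (hζS : ζ ∈ Γs.divisorSet) :
    ∀ J ∈ Γs.cureAlong ζ, J ≠ ⊥ := by
  intro J hJ
  rcases Boundary.mem_cureAlong_iff.mp hJ with ⟨Γ, hΓ, rfl⟩ | rfl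
  · exact fun h => hne Γ hΓ (le_bot_iff.mp (h ▸ le_cureMember ζ Γ))
  · intro h
    obtain ⟨Γ, hΓ, hζΓ⟩ := Boundary.mem_divisorSet_iff.mp hζS
    have hgen : genericPoint D ∈ ((primeDivisorIdeal ζ).support : Set D) := by
      rw [h, Scheme.IdealSheafData.support_bot]; trivial
    rw [SetLike.mem_coe, mem_support_primeDivisorIdeal_iff] at hgen
    have heq : ζ = genericPoint D := (hgen.antisymm (genericPoint_specializes ζ)).eq
    exact not_mem_support_genericPoint (hne Γ hΓ) (heq ▸ hζΓ)

end Laws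

end Summit.ResolutionOfSingularities.ResolutionOfSingularities.Theorems.SigmaMaxModificationsCorridor3.Sigma

end
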